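import Mathlib
import HarnessLib
import Summits.Parity.GeneralizedHardyLittlewood.Theses.LiouvilleMAD
import Summits.Parity.GeneralizedHardyLittlewood.Theorems.DilatedChowla.Negative.DilatedChowlaMirrorDefs

/-!
# Crux `DilatedChowla` (stmt-Parity-13319) — crux-ideate round 2, ideator 4: two faces, kernel-checked

Companion file of `IDEATOR4-r2-report.md` (same crux directory).  NOT a line (no `DilatedChowla_of`:
none can exist with a provable stub set, see the report §0); this file records, sorry-free, the two
identities the report's verdict rests on, in the vocabulary of the landed base file
`Theorems/DilatedChowla/Negative/DilatedChowlaMirrorDefs` (`S`, `L`, `dilatedChowla_iff`).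

* **F0 (binary core).** `S (2h) 2 1 M = −Σ_{m∈(M,2M]} λ(m+h)λ(m+2h)` (`S_two_one_eq`), i.e. the crux's
  single instance `(c,n,n') = (2h,2,1)` is verbatim the classical two-point Chowla sum with shift `h`
  on the window `V = m+h ∈ (M+h, 2M+h]` (`window_shift`).  Hence
  `powerChowlaTwoWindows_of_dilatedChowla : DilatedChowla → PowerChowlaTwoWindows` — ANY proof of the
  crux proves power-saving binary Chowla `Σ_{V∈(M+h,2M+h]} λ(V)λ(V+h) ≪_h M^{1−κ}` for every shift
  `h ≥ 1` (open; un-averaged two-point Chowla is not known even with `o(M)`: Tao FMP 2016 /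
  Helfgott–Radziwiłł / Pilatte JAMS 2026 are logarithmically averaged with `(log)^{−c}` savings).
* **F1 (AP normal form).** `λ(mn+c)λ(mn'+c) = λ(nn')·λ(U)·λ(U + c(n−n'))`, `U = n'(mn+c) = nn'm + cn'`
  (`normalForm_term`, `normalForm_S`): the pencil sum at `(c,n,n')` is the two-point Chowla sum with
  shift `Δ = c(n−n')` restricted to the ONE residue class `cn' mod nn'`, `M` terms, modulus
  `q = nn' ≤ 4M²`, height `x ≍ qM`, so `q ≍ x^{2/3}` at balanced dilations: a pair sequence in one class
  at `x = q^{3/2} < q²` — below the square-root barrier already for ONE-point statements (Ford–Radziwiłł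
  arXiv:2605.03349 Thm 1: a sign change of `λ` in a class mod `q` is known only below `q^{5/2+ε}`,
  `q^{2+ε}` under GRH / Matomäki–Teräväinen).

Nothing here is cited content; no `sorry`.
-/

noncomputable section

namespace Summit.Parity.GeneralizedHardyLittlewood.Cruxes.DilatedChowla.Ideator4

open Summit.Parity.GeneralizedHardyLittlewood.Theses.LiouvilleMAD
open Summit.Parity.GeneralizedHardyLittlewood.Theorems.DilatedTableChowla.Negative
  (L toNat_ne_zero_of_pos L_of_pos L_mul_self_of_pos L_nonpos_arg abs_L_le_one L_natCast
    L_natCast_mul)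
open Summit.Parity.GeneralizedHardyLittlewood.Theorems.DilatedChowla.Negative
  (S dilatedChowla_iff abs_S_le)
open Finset

/-! ## §0 Two small facts about `L z = λ(z.toNat)` -/

/-- `λ(2) = −1`. -/
theorem L_two : L 2 = -1 := by
  have h : L ((2 : ℕ) : ℤ) = (ArithmeticFunction.liouville 2 : ℝ) := L_natCast 2
  have h2 : ArithmeticFunction.liouville 2 = -1 := by
    rw [ArithmeticFunction.liouville_apply (by norm_num),
      ArithmeticFunction.cardFactors_apply_prime Nat.prime_two]
    norm_num
  have e : ((2 : ℕ) : ℤ) = 2 := by norm_num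
  rw [e] at h
  rw [h, h2]
  norm_num

/-- Complete multiplicativity with a natural factor and a nonnegative integer cofactor. -/
theorem L_natCast_mul_of_nonneg (a : ℕ) {z : ℤ} (hz : 0 ≤ z) : L ((a : ℤ) * z) = L a * L z := by
  obtain ⟨k, rfl⟩ := Int.eq_ofNat_of_zero_le hz
  exact L_natCast_mul a k

/-! ## §1 F0 — the binary core: `(c, n, n') = (2h, 2, 1)` is classical two-point Chowla -/

/-- Per-term identity: `λ(2m+2h)·λ(m+2h) = −λ(m+h)·λ(m+2h)` (`λ(2(m+h)) = λ(2)λ(m+h)`). -/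
theorem term_two_one (m h : ℕ) :
    L ((m : ℤ) * 2 + 2 * h) * L ((m : ℤ) * 1 + 2 * h)
      = -(L ((m : ℤ) + h) * L ((m : ℤ) + 2 * h)) := by
  have e1 : (m : ℤ) * 2 + 2 * h = ((2 : ℕ) : ℤ) * ((m : ℤ) + h) := by push_cast; ring
  have e2 : (m : ℤ) * 1 + 2 * h = (m : ℤ) + 2 * h := by ring
  have hpos : 0 ≤ (m : ℤ) + h := by positivity
  have h2 : L ((2 : ℕ) : ℤ) = -1 := by
    rw [show ((2 : ℕ) : ℤ) = 2 by norm_num]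
    exact L_two
  rw [e1, e2, L_natCast_mul_of_nonneg 2 hpos, h2]
  ring

/-- **F0.** The crux's pencil sum at shift `c = 2h` and dilations `(2,1)` is minus the classical
two-point Chowla sum with shift `h` over `m ∈ (M, 2M]`. -/
theorem S_two_one_eq (h M : ℕ) :
    S (2 * (h : ℤ)) 2 1 M = -∑ m ∈ Ioc M (2 * M), L ((m : ℤ) + h) * L ((m : ℤ) + 2 * h) := by
  unfold S
  rw [← sum_neg_distrib]
  refine sum_congr rfl fun m _ => ?_
  have := term_two_one m h
  push_cast
  exact this

/-- The same sum in the variable `V = m + h ∈ (M+h, 2M+h]`: it is `Σ λ(V)λ(V+h)`. -/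
theorem window_shift (h M : ℕ) :
    ∑ V ∈ Ioc (M + h) (2 * M + h), L (V : ℤ) * L ((V : ℤ) + h)
      = ∑ m ∈ Ioc M (2 * M), L ((m : ℤ) + h) * L ((m : ℤ) + 2 * h) := by
  rw [← Finset.map_add_right_Ioc, Finset.sum_map]
  refine sum_congr rfl fun m _ => ?_
  simp only [addRightEmbedding_apply]
  push_cast
  ring_nf

/-- Power-saving classical two-point Chowla on dyadic windows: for every shift `h ≥ 1` there are
`κ > 0`, `C` with `|Σ_{V ∈ (M+h, 2M+h]} λ(V) λ(V+h)| ≤ C·M^{1−κ}` for all `M`.  (Open: binary,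
infinite complexity; no mechanism in print gives un-averaged two-point cancellation, let alone a
power — `Literature.Barriers.Parity.TrueComplexityBinary`, Tao FMP 2016, Pilatte JAMS 2026.) -/
def PowerChowlaTwoWindows : Prop :=
  ∀ h : ℕ, 1 ≤ h → ∃ κ : ℝ, 0 < κ ∧ ∃ C : ℝ, ∀ M : ℕ,
    |∑ V ∈ Ioc (M + h) (2 * M + h), L (V : ℤ) * L ((V : ℤ) + h)| ≤ C * (M : ℝ) ^ (1 - κ)

/-- **Face F0: the crux contains power-saving binary Chowla.**  Specialise `DilatedChowla` at
`c = 2h ≠ 0`, `(n, n') = (2, 1)` (admissible for every `M ≥ 1`) and use `S_two_one_eq`. -/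
theorem powerChowlaTwoWindows_of_dilatedChowla (hD : DilatedChowla) : PowerChowlaTwoWindows := by
  intro h hh
  have hc : (2 * (h : ℤ)) ≠ 0 := by omega
  obtain ⟨κ, hκ, C, hC⟩ := (dilatedChowla_iff.mp hD) (2 * (h : ℤ)) hc
  refine ⟨κ, hκ, |C|, fun M => ?_⟩
  rw [window_shift]
  rcases Nat.eq_zero_or_pos M with rfl | hM
  · simp only [mul_zero, Ioc_self, sum_empty, abs_zero, Nat.cast_zero]
    exact mul_nonneg (abs_nonneg C) (Real.rpow_nonneg le_rfl _)
  · have key := hC M 2 1 (by norm_num) le_rfl (by norm_num) (by omega) (by omega)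
    rw [S_two_one_eq, abs_neg] at key
    exact key.trans (mul_le_mul_of_nonneg_right (le_abs_self C) (Real.rpow_nonneg (by positivity) _))

/-! ## §2 F1 — the AP normal form: the pencil is two-point Chowla in ONE class mod `nn'` -/

/-- The two "completed" arguments differ by the constant `Δ = c(n − n')`:
`n(mn'+c) = n'(mn+c) + c(n−n')`. -/
theorem completed_args (c : ℤ) (m n n' : ℕ) :
    (n : ℤ) * ((m : ℤ) * n' + c) = (n' : ℤ) * ((m : ℤ) * n + c) + c * ((n : ℤ) - n') := by
  ring

/-- **F1, per term.**  For `n, n' ≥ 1` and positive arguments,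
`λ(mn+c)·λ(mn'+c) = λ(nn') · λ(U) · λ(U + c(n−n'))` with `U = n'(mn+c) = nn'm + cn'`
(multiply the first argument by `n'` and the second by `n`; `λ(n)² = λ(n')² = 1`). -/
theorem normalForm_term {c : ℤ} {m n n' : ℕ} (hn : 1 ≤ n) (hn' : 1 ≤ n')
    (hu : 0 < (m : ℤ) * n + c) (hv : 0 < (m : ℤ) * n' + c) :
    L ((m : ℤ) * n + c) * L ((m : ℤ) * n' + c)
      = L ((n : ℤ) * n') *
          (L ((n' : ℤ) * ((m : ℤ) * n + c)) * L ((n' : ℤ) * ((m : ℤ) * n + c) + c * ((n : ℤ) - n'))) := by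
  rw [← completed_args c m n n', L_natCast_mul_of_nonneg n' hu.le, L_natCast_mul_of_nonneg n hv.le,
    L_natCast_mul n n']
  have h1 : L (n : ℤ) * L (n : ℤ) = 1 := L_mul_self_of_pos (by exact_mod_cast hn)
  have h2 : L (n' : ℤ) * L (n' : ℤ) = 1 := L_mul_self_of_pos (by exact_mod_cast hn')
  have h12 : L (n : ℤ) * L (n : ℤ) * (L (n' : ℤ) * L (n' : ℤ)) = 1 := by rw [h1, h2, one_mul]
  linear_combination (-(L ((m : ℤ) * n + c) * L ((m : ℤ) * n' + c))) * h12

/-- **F1, summed.**  Once all arguments are positive (`M + c ≥ 0` suffices, since `m ≥ M+1`,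
`n, n' ≥ 1`), the pencil sum is `λ(nn')` times the two-point Chowla sum with shift `c(n−n')` along
the progression `U = nn'm + cn' ≡ cn' (mod nn')`, `m ∈ (M, 2M]`:
`S c n n' M = λ(nn') · Σ_{m∈(M,2M]} λ(U_m) λ(U_m + c(n−n'))`. -/
theorem normalForm_S {c : ℤ} {n n' M : ℕ} (hn : 1 ≤ n) (hn' : 1 ≤ n') (hMc : 0 ≤ (M : ℤ) + c) :
    S c n n' M
      = L ((n : ℤ) * n') * ∑ m ∈ Ioc M (2 * M),
          L ((n' : ℤ) * ((m : ℤ) * n + c)) * L ((n' : ℤ) * ((m : ℤ) * n + c) + c * ((n : ℤ) - n')) := by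
  unfold S
  rw [mul_sum]
  refine sum_congr rfl fun m hm => ?_
  rw [mem_Ioc] at hm
  have hm1 : (M : ℤ) + 1 ≤ m := by exact_mod_cast hm.1
  have hn1 : (1 : ℤ) ≤ n := by exact_mod_cast hn
  have hn1' : (1 : ℤ) ≤ n' := by exact_mod_cast hn'
  have hu : 0 < (m : ℤ) * n + c := by nlinarith
  have hv : 0 < (m : ℤ) * n' + c := by nlinarith
  exact normalForm_term hn hn' hu hv

/-- Reading of F1 (bookkeeping, exact): the progression variable `U = nn'm + cn'` runs over the
`M` terms of the class `cn' mod nn'` inside `(nn'M + cn', 2nn'M + cn']`. -/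
theorem progression_value (c : ℤ) (m n n' : ℕ) :
    (n' : ℤ) * ((m : ℤ) * n + c) = ((n : ℤ) * n') * m + c * n' := by
  ring

end Summit.Parity.GeneralizedHardyLittlewood.Cruxes.DilatedChowla.Ideator4

end
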